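import Summits.FinalStateConjecture.FinalStateConjecture.Theses.BondiDrainDispersal
import Summits.FinalStateConjecture.FinalStateConjecture.Theorems.BondiDrainDispersalHorizonlessMustDrainMinkowskiConeSection
import Summits.FinalStateConjecture.FinalStateConjecture.Theorems.BondiDrainDispersalHorizonlessMustDrainMinkowskiSphereSection
import Summits.FinalStateConjecture.FinalStateConjecture.Theorems.BondiDrainDispersalHorizonlessMustDrainMinkowskiSectionArea
import Summits.FinalStateConjecture.FinalStateConjecture.Theorems.BondiDrainDispersalHorizonlessMustDrainMinkowskiSectionGauss
import Summits.FinalStateConjecture.FinalStateConjecture.Theorems.BondiDrainDispersalHorizonlessMustDrainMinkowskiSectionNullExpansion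
import Summits.FinalStateConjecture.FinalStateConjecture.Theorems.BondiDrainDispersalHorizonlessMustDrainHasVanishingFinalBondiMassTransport
import Literature.Geometry.Lorentzian.CompleteDevelopmentMaximal
import HarnessLib

/-!
# `HorizonlessMustDrain` on the fibre over the trivial datum: Minkowski space has vanishing final Bondi mass

Sanity tier of line `registered` (= `Cruxes/HorizonlessMustDrain/Lines/birth.lean`) of the crux
`Theses.BondiDrainDispersal.HorizonlessMustDrain` (item stmt-FinalStateConjecture-9976, route BondiDrainDispersal; lead c2,
2026-08-17): the ASSEMBLY of the six landed stubs S1–S6 (`stub_minkowskiConeSection` p149417, `stub_minkowskiSphereSection`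
p149853, `stub_minkowskiSectionArea` p149938, `stub_minkowskiSectionGauss` p150364, `stub_minkowskiSectionNullExpansion`
p150198, `stub_hasVanishingFinalBondiMass_transport` p149707) into

* `minkowski_hasCutBondiMass_origin_zero` — the round sections `{t = ρ, |x| = ρ}`, `ρ(s) = max s 1`, of the light cone
  `∂J⁺({0})` of the Minkowski development form a `CauchyDevelopment.RoundSectionFamily` (the FIRST inhabitant of that
  structure in the tree; `KissingBallsCutMass.lean` has only an emptiness theorem) all of whose Hawking masses vanish
  (`θ_L θ_L̲ = -4/ρ²`, `|S| = 4πρ²`, `∫ θθ̲ dA = -16π`): the cut has Bondi mass `0`;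
* `stub_minkowskiVanishingFinalBondiMass` (registered glue stub) — **Minkowski space, as the vacuum Cauchy development of
  `(ℝ³, δ, 0)`, has vanishing final Bondi mass** (`CauchyDevelopment.HasVanishingFinalBondiMass`, definition N1 of
  `CutBondiMass.lean`, whose module docstring left this as "Sanity (not formalised)");
* `stub_trivialDatumFibre` (registered glue stub) — **the crux `HorizonlessMustDrain` holds on the whole fibre over the trivial
  datum**: every maximal vacuum Cauchy development of `(ℝ³, δ, 0)` has vanishing final Bondi mass (unconditionally; a maximal
  development is isometric, as a development, to Minkowski space, `Minkowski.isIsometricTo_vacuumCauchyDevelopment_of_isMaximal`,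
  and N1 is invariant under isometry of developments, S6) — the analogue for this crux of
  `Theorems/DrainImpliesDisperse/Negative/TrivialDatumFibre.lean`: the conclusion of the crux is satisfiable in its exact
  typing, a counterexample needs a NON-FLAT admissible datum;
* `horizonlessMustDrain_specialises` — typing link: the crux, specialised at the trivial datum, is literally the fibre
  statement.

Everything is proved (no `sorry`, no new definition, no named fact); the items do not close the crux (open problem for
general data) and are filed `--supports stmt-FinalStateConjecture-9976`.

## References

* D. Christodoulou, S. Klainerman, *The global nonlinear stability of the Minkowski space*, Princeton 1993, Ch. 17
  ((17.0.2), Conclusion 17.0.4: Hawking mass → Bondi mass, `M ≡ 0` for Minkowski space). [ChristodoulouKlainerman1993]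
* S. W. Hawking, J. Math. Phys. 9 (1968) 598, (3.7) (the Hawking mass). [Hawking1968]
* Y. Choquet-Bruhat, R. Geroch, Comm. Math. Phys. 14 (1969) 329–335, Thm. 3 (MGHD unique up to isometry). [ChoquetBruhatGeroch1969CMP]
* H. Ringström, *The Cauchy Problem in General Relativity* (2009), Thm. 16.6. [Ringstrom2009]
-/

set_option linter.dupNamespace false

noncomputable section

open scoped Manifold ContDiff Topology
open Filter Set Function Metric MeasureTheory Literature.Geometry.Lorentzian

namespace Summit.FinalStateConjecture.FinalStateConjecture.Theorems.BondiDrainDispersalHorizonlessMustDrain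

open Summit.FinalStateConjecture.FinalStateConjecture.Theses.BondiDrainDispersal (HorizonlessMustDrain)

open Literature.Geometry.Lorentzian.Minkowski in
/-- **The cut of `𝓘⁺` by the light cone of the origin of Minkowski spacetime has Bondi mass `0`**: the round sections
`S_{ρ(s)} = {t = ρ(s), |x| = ρ(s)}`, `ρ(s) = max s 1`, of `∂J⁺({0})` form a round receding family
(`CauchyDevelopment.RoundSectionFamily`) — on the cone with the generators `t ↦ (ρ + t, (ρ + t) y)` tangent to
`L = (1, y)` (S1, S2), areas `4πρ² → ∞` (S3), `K · |S| / 4π = ρ⁻² · 4πρ² / 4π = 1` identically (S3, S4) — all of whose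
Hawking masses vanish: `∫ θ_L θ_L̲ dA = (2/ρ)(-2/ρ) · 4πρ² = -16π` (S3, S5, `hawkingMass_eq_zero_of_integral_eq`).
This is the "Sanity (not formalised)" remark of `CutBondiMass.lean`, formalised (from the landed stubs S1–S5).
[cite: ChristodoulouKlainerman1993, Ch. 17, Conclusion 17.0.4] -/
theorem minkowski_hasCutBondiMass_origin_zero :
    vacuumCauchyDevelopment.toCauchyDevelopment.HasCutBondiMass {(0 : E4)} 0 := by
  classical
  -- radii `ρ s = max s 1 > 0`, `ρ s → ∞`
  set ρ : ℝ → ℝ := fun s ↦ max s 1 with hρ_def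
  have hρ : ∀ s, 0 < ρ s := fun s ↦ lt_of_lt_of_le one_pos (le_max_right _ _)
  have hρtop : Tendsto ρ atTop atTop := tendsto_atTop_mono (fun s ↦ le_max_left s 1) tendsto_id
  -- S2: embedding, spacelikeness, null normal pair (chosen)
  have hS2 := fun s ↦ stub_minkowskiSphereSection (ρ s) (hρ s)
  let P : ∀ s : ℝ, LorentzianMetric.NullNormalPair (𝓡 2) vacuumCauchyDevelopment.toCauchyDevelopment.metric
      vacuumCauchyDevelopment.toCauchyDevelopment.timeOrientation
      (fun y : sphere (0 : E3) 1 ↦ E4.ofTimeSpace (ρ s) (ρ s • (y : E3))) :=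
    fun s ↦ Classical.choose (hS2 s).2.2
  have hP : ∀ s, (∀ y, (P s).L y = E4.ofTimeSpace 1 (y : E3)) ∧
      (∀ y, (P s).Lbar y = E4.ofTimeSpace 1 (-(y : E3))) :=
    fun s ↦ Classical.choose_spec (hS2 s).2.2
  -- S3: the areas
  have hA : ∀ s, vacuumCauchyDevelopment.toCauchyDevelopment.metric.surfaceArea
      (fun y : sphere (0 : E3) 1 ↦ E4.ofTimeSpace (ρ s) (ρ s • (y : E3))) (hS2 s).2.1 =
        ENNReal.ofReal (4 * Real.pi * ρ s ^ 2) :=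
    fun s ↦ stub_minkowskiSectionArea (ρ s) (hρ s) (hS2 s).2.1
  have hA' : ∀ s, (vacuumCauchyDevelopment.toCauchyDevelopment.metric.surfaceArea
      (fun y : sphere (0 : E3) 1 ↦ E4.ofTimeSpace (ρ s) (ρ s • (y : E3))) (hS2 s).2.1).toReal =
        4 * Real.pi * ρ s ^ 2 :=
    fun s ↦ by rw [hA s, ENNReal.toReal_ofReal (by positivity)]
  -- the family
  let 𝓕 : CauchyDevelopment.RoundSectionFamily vacuumCauchyDevelopment.toCauchyDevelopment {(0 : E4)} :=
    { sec := fun s y ↦ E4.ofTimeSpace (ρ s) (ρ s • (y : E3))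
      range_sec_subset := fun s ↦ by
        rintro _ ⟨y, rfl⟩
        exact (stub_minkowskiConeSection (ρ s) (hρ s) y).1
      isSmoothEmbedding := fun s ↦ (hS2 s).1
      isSpacelike := fun s ↦ (hS2 s).2.1
      pair := P
      tangent_L := fun s y ↦ by
        refine ⟨fun t : ℝ ↦ E4.ofTimeSpace (ρ s + t) ((ρ s + t) • (y : E3)), ρ s, hρ s,
          (stub_minkowskiConeSection (ρ s) (hρ s) y).2.1, by simp, ?_, fun t ht ↦ ?_⟩
        · rw [(hP s).1 y]
          exact (stub_minkowskiConeSection (ρ s) (hρ s) y).2.2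
        · exact (stub_minkowskiConeSection (ρ s + t) (by linarith [hρ s, ht.1]) y).1
      tendsto_area := by
        have h : (fun s ↦ vacuumCauchyDevelopment.toCauchyDevelopment.metric.surfaceArea
            (fun y : sphere (0 : E3) 1 ↦ E4.ofTimeSpace (ρ s) (ρ s • (y : E3))) (hS2 s).2.1) =
            fun s ↦ ENNReal.ofReal (4 * Real.pi * ρ s ^ 2) := funext hA
        rw [h]
        refine ENNReal.tendsto_ofReal_atTop.comp ?_
        refine Tendsto.const_mul_atTop (by positivity) ?_
        exact (tendsto_pow_atTop two_ne_zero).comp hρtop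
      round := by
        refine Metric.tendstoUniformly_iff.2 fun ε hε ↦ Filter.Eventually.of_forall fun s y ↦ ?_
        rw [stub_minkowskiSectionGauss (ρ s) (hρ s) (hS2 s).2.1 y, hA' s]
        have : 1 / ρ s ^ 2 * (4 * Real.pi * ρ s ^ 2) / (4 * Real.pi) = 1 := by
          field_simp [(hρ s).ne']
        rw [this, dist_self]
        exact hε }
  refine ⟨𝓕, 𝓕.hasMassLimit_zero_of_eventually_eq (Filter.Eventually.of_forall fun s ↦ ?_)⟩
  -- every Hawking mass vanishes: `∫ θ_L θ_L̲ dA = -(4/ρ²) · 4πρ² = -16π`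
  haveI := vacuumCauchyDevelopment.toCauchyDevelopment.metric.toPseudoRiemannianMetric.hasLeviCivita
  unfold CauchyDevelopment.RoundSectionFamily.hawkingMass
  refine LorentzianMetric.hawkingMass_eq_zero_of_integral_eq _ _
    PseudoRiemannianMetric.contMDiff_pullbackBilin_holds ((hS2 s).2.1) (P s) ?_
  have hθ := stub_minkowskiSectionNullExpansion (ρ s) (hρ s) (hS2 s).2.1 (P s) (hP s).1 (hP s).2
  have hconst : (fun y : sphere (0 : E3) 1 ↦
      vacuumCauchyDevelopment.toCauchyDevelopment.metric.nullExpansion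
          (fun y : sphere (0 : E3) 1 ↦ E4.ofTimeSpace (ρ s) (ρ s • (y : E3)))
          PseudoRiemannianMetric.contMDiff_pullbackBilin_holds (hS2 s).2.1 (P s).L y *
        vacuumCauchyDevelopment.toCauchyDevelopment.metric.nullExpansion
          (fun y : sphere (0 : E3) 1 ↦ E4.ofTimeSpace (ρ s) (ρ s • (y : E3)))
          PseudoRiemannianMetric.contMDiff_pullbackBilin_holds (hS2 s).2.1 (P s).Lbar y) =
      fun _ ↦ -(4 / ρ s ^ 2) := by
    funext y
    rw [(hθ y).1, (hθ y).2]
    field_simp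
    ring
  rw [hconst, MeasureTheory.integral_const, smul_eq_mul]
  -- the total mass of the area measure is the area `4πρ²`
  have hμ : ((riemannianVolume (vacuumCauchyDevelopment.toCauchyDevelopment.metric.inducedRiemannianMetric
      (fun y : sphere (0 : E3) 1 ↦ E4.ofTimeSpace (ρ s) (ρ s • (y : E3)))
      PseudoRiemannianMetric.contMDiff_pullbackBilin_holds (hS2 s).2.1) 2) Set.univ).toReal =
        4 * Real.pi * ρ s ^ 2 := hA' s
  rw [Measure.real, hμ]
  field_simp [(hρ s).ne']
  ring

open Literature.Geometry.Lorentzian.Minkowski in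
/-- **Minkowski spacetime, as the vacuum Cauchy development of `(ℝ³, δ, 0)`, has vanishing final Bondi mass**
(`CauchyDevelopment.HasVanishingFinalBondiMass`; from the cut of Bondi mass `0` on the compact set `{0}`,
`HasCutBondiMass.hasVanishingFinalBondiMass`).  The first inhabitant of definition N1 in the tree.  Registered glue stub of line `registered` of crux
stmt-FinalStateConjecture-9976. [cite: ChristodoulouKlainerman1993, Ch. 17, Conclusion 17.0.4] -/
theorem stub_minkowskiVanishingFinalBondiMass :
    Literature.Geometry.Lorentzian.Minkowski.vacuumCauchyDevelopment.toCauchyDevelopment.HasVanishingFinalBondiMass :=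
  minkowski_hasCutBondiMass_origin_zero.hasVanishingFinalBondiMass isCompact_singleton

/-- **`HorizonlessMustDrain` HOLDS ON THE FIBRE OVER THE TRIVIAL DATUM** (`X = ℝ³ = Minkowski.slice`, `D = trivialData`,
EVERY maximal vacuum Cauchy development; unconditionally, its hypotheses complete `𝓘⁺` and no horizon idle): a maximal
development of the trivial datum is isometric, as a development, to Minkowski space
(`Minkowski.isIsometricTo_vacuumCauchyDevelopment_of_isMaximal`, geodesic completeness ⇒ onto), which has vanishing final
Bondi mass (`stub_minkowskiVanishingFinalBondiMass`), a property invariant under isometry of developments (S6).  So the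
crux's conclusion is satisfiable in its exact typing and a counterexample to the crux needs a NON-FLAT admissible datum —
the analogue for this crux of `Theorems/DrainImpliesDisperse/Negative/TrivialDatumFibre.lean`.  Registered glue stub of line `registered`
of crux stmt-FinalStateConjecture-9976; its hypotheses complete `𝓘⁺` / no horizon are idle here (they HOLD on this fibre, see the
wave-2 companion file). [cite: Ringstrom2009, Thm. 16.6] -/
theorem stub_trivialDatumFibre :
    ∀ 𝒟 : Literature.Geometry.Lorentzian.VacuumCauchyDevelopment Literature.Geometry.Lorentzian.trivialData, 𝒟.IsMaximal →
      Summit.FinalStateConjecture.HasCompleteNullInfinity 𝒟.toCauchyDevelopment →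
      ¬ (∀ [𝒟.metric.HasLeviCivita], ∃ q : 𝒟.carrier, ∀ (p : Literature.Geometry.Lorentzian.Minkowski.slice) (γ : ℝ → 𝒟.carrier) (dom : Set ℝ),
          𝒟.metric.IsNormalisedNullRayFrom 𝒟.timeOrientation 𝒟.embed 𝒟.normal p γ dom → ¬ BddAbove dom →
            q ∉ 𝒟.metric.chronologicalPast 𝒟.timeOrientation (γ '' (dom ∩ Set.Ici 0))) →
      𝒟.toCauchyDevelopment.HasVanishingFinalBondiMass :=
  fun _ hmax _ _ ↦
    stub_hasVanishingFinalBondiMass_transport _ _ (Minkowski.isIsometricTo_vacuumCauchyDevelopment_of_isMaximal hmax)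
      stub_minkowskiVanishingFinalBondiMass

/-- **Typing link**: the crux, specialised to the trivial datum, is exactly the fibre statement above (so the fibre
theorem is the crux's own prediction there, kernel-checked against the route decl by name). [folklore] -/
theorem horizonlessMustDrain_specialises (h : HorizonlessMustDrain) :
    ∀ 𝒟 : VacuumCauchyDevelopment trivialData, 𝒟.IsMaximal →
      Summit.FinalStateConjecture.HasCompleteNullInfinity 𝒟.toCauchyDevelopment →
      ¬ (∀ [𝒟.metric.HasLeviCivita], ∃ q : 𝒟.carrier, ∀ (p : Minkowski.slice) (γ : ℝ → 𝒟.carrier) (dom : Set ℝ),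
          𝒟.metric.IsNormalisedNullRayFrom 𝒟.timeOrientation 𝒟.embed 𝒟.normal p γ dom → ¬ BddAbove dom →
            q ∉ 𝒟.metric.chronologicalPast 𝒟.timeOrientation (γ '' (dom ∩ Set.Ici 0))) →
      𝒟.toCauchyDevelopment.HasVanishingFinalBondiMass :=
  fun 𝒟 hmax hscri hH ↦ h Minkowski.slice trivialData trivialData_mem_admissibleVacuumData 𝒟 hmax hscri hH



end Summit.FinalStateConjecture.FinalStateConjecture.Theorems.BondiDrainDispersalHorizonlessMustDrain

end
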